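import Summits.MatrixMultiplication.MatrixMultiplication.Theorems.EdgePencilSixth
import HarnessLib

/-!
# The sixth-edge ladder, finite level: Kronecker products IN THE BOND
# `R₄(W_{N·M}^{(e₁·e₂)}) ≤ R₄(W_N^{(e₁)}) · R₄(W_M^{(e₂)})`

Support kernel for `stmt-MatrixMultiplication-26697` (`TetraExcessZero : ω(K₄) ≤ ω(2,1,2)`, the
attacked leaf of route `TetrahedronCarving`; lineage `decomp-mm-lens-6` «barrier-complement carving»,
generation 24). No item is added or changed; no definition.

THE OBJECT. `W_n^{(e)} = χ[ℓ₀₁ < e] · T(K₄)_n` (`EdgePencil.sixTetra`, kernel `EdgePencilSixth`): the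
tetrahedron graph tensor with bond `e` on the edge `01` and bond `n` on the other five edges; its
exponent along `e = ⌈n^δ⌉` is `χ(δ) = omegaSix F δ` (`EdgePencilSixthLadder`).

THE MOVE. Graph tensors multiply edge-wise under the Kronecker product (CVZ19 §1.1): the product of
`W_N^{(e₁)}` and `W_M^{(e₂)}` is the `K₄`-tensor at level `N·M` whose edge `01` carries the BOX
`[e₁] × [e₂] ⊆ [N] × [M]` instead of an initial segment. A permutation of the `N·M` labels of edge `01`
(applied at both endpoints, which fixes `T(K₄)_{N·M}`: `tetra_relab₀₁`) carries the initial segment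
`[e₁·e₂]` onto the box (`exists_perm_box`, a cardinality argument: both have `e₁·e₂` elements when
`e₁ ≤ N`, `e₂ ≤ M`), so `W_{N·M}^{(e₁·e₂)}` is a pullback of the product and
  `R₄(W_{N·M}^{(e₁·e₂)}) ≤ R₄(W_N^{(e₁)}) · R₄(W_M^{(e₂)})`   (`tensorRankD_sixTetra_kron_le`).
Together with monotonicity in the level (`tensorRankD_sixTetra_mono_level`, zero-padding) this is the
finite-level input of the CONVEXITY of `δ ↦ χ(δ)` on `[0,1]` (companion module
`EdgePencilSixthConvexity`, the Lotti–Romani template of `RectangularExponentProofs`).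

* §1 level monotonicity `R₄(W_m^{(e)}) ≤ R₄(W_{m'}^{(e)})` (`m ≤ m'`).
* §2 the box permutation of `Fin (N·M)`.
* §3 the Kronecker product in the bond, pointwise (`sixKron_pullback_apply`) and in rank
  (`tensorRankD_sixTetra_kron_le`); corollary: thin ⊠ full, `R₄(W_{N·M}^{(e·M)}) ≤ R₄(W_N^{(e)})·R₄(T(K₄)_M)`.

References: Christandl–Vrana–Zuiddam, arXiv:1609.07476, Ex. 1.1.2, §1.1 (graph tensors with
non-uniform bond dimensions multiply edge-wise under `⊠`; restriction), Prop. 1.1.16 (proof)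
[ChristandlVranaZuiddam2016]; Lotti–Romani 1983 §1 (subadditivity of exponents) [LottiRomani1983].
No `sorry`, no new axiom, no instance, no notation, no definition.
-/

noncomputable section

set_option linter.dupNamespace false

open Finset Literature.Computability.AlgebraicComplexity
open Summit.MatrixMultiplication.MatrixMultiplication.Theorems.TetrahedronTensor
open Summit.MatrixMultiplication.MatrixMultiplication.Theorems.TetraDiagonal

namespace Summit.MatrixMultiplication.MatrixMultiplication.Theorems.EdgePencil

/-! ## §1 Monotonicity in the level -/

section Level

variable {F : Type*} [Field F]

/-- `W_m^{(e)}` is the pullback of `W_{m'}^{(e)}` along the label embedding `Fin m ↪ Fin m'` on all six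
edges (`m ≤ m'`; the test `ℓ₀₁ < e` is unchanged since the embedding preserves values). [folklore] -/
theorem sixTetra_eq_pullback_level {m m' : ℕ} (h : m ≤ m') (e : ℕ) :
    sixTetra F m e = fun i : Fin 4 → Fin (m ^ 3) =>
      sixTetra F m' e (fun v => finFunctionFinEquiv
        (fun j => Fin.castLE h (finFunctionFinEquiv.symm (i v) j))) := by
  funext i
  have ht := congrFun (tetra_eq_pullback (F := F) h) i
  simp only [sixTetra]
  rw [ht]
  congr 1
  simp only [thinInd, Equiv.symm_apply_apply, Fin.val_castLE]

/-- **Monotonicity in the level**: `R₄(W_m^{(e)}) ≤ R₄(W_{m'}^{(e)})` for `m ≤ m'` (zero-padding).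
[folklore] -/
theorem tensorRankD_sixTetra_mono_level {m m' : ℕ} (h : m ≤ m') (e : ℕ) :
    tensorRankD (sixTetra F m e) ≤ tensorRankD (sixTetra F m' e) := by
  rw [sixTetra_eq_pullback_level (F := F) h e]
  exact tensorRankD_pullback_le (sixTetra F m' e)
    (fun _ x => finFunctionFinEquiv (fun j => Fin.castLE h (finFunctionFinEquiv.symm x j)))
    (sixTetra_decomposable m' e)

end Level

/-! ## §2 The box permutation -/

section Box

/-- **Box permutation.** For `e₁ ≤ N`, `e₂ ≤ M` there is a permutation `σ` of `Fin (N·M)` such that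
`σ z` lies in the box `{(a, b) : a < e₁, b < e₂}` (pair coordinates via `finProdFinEquiv`) iff
`z < e₁·e₂`: both the initial segment and the box have `e₁·e₂` elements, and so do their complements.
[folklore] -/
theorem exists_perm_box {N M e₁ e₂ : ℕ} (h₁ : e₁ ≤ N) (h₂ : e₂ ≤ M) :
    ∃ σ : Equiv.Perm (Fin (N * M)), ∀ z : Fin (N * M),
      ((((finProdFinEquiv.symm (σ z)).1 : Fin N) : ℕ) < e₁ ∧
          (((finProdFinEquiv.symm (σ z)).2 : Fin M) : ℕ) < e₂) ↔ (z : ℕ) < e₁ * e₂ := by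
  have hp : Fintype.card {z : Fin (N * M) // (z : ℕ) < e₁ * e₂} = e₁ * e₂ :=
    Fintype.card_fin_lt_of_le (Nat.mul_le_mul h₁ h₂)
  have eq : {y : Fin (N * M) // (((finProdFinEquiv.symm y).1 : Fin N) : ℕ) < e₁ ∧
      (((finProdFinEquiv.symm y).2 : Fin M) : ℕ) < e₂} ≃
      {a : Fin N // (a : ℕ) < e₁} × {b : Fin M // (b : ℕ) < e₂} :=
    (Equiv.subtypeEquiv
      (p := fun y : Fin (N * M) => (((finProdFinEquiv.symm y).1 : Fin N) : ℕ) < e₁ ∧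
        (((finProdFinEquiv.symm y).2 : Fin M) : ℕ) < e₂)
      (q := fun c : Fin N × Fin M => ((c.1 : ℕ) < e₁ ∧ (c.2 : ℕ) < e₂))
      finProdFinEquiv.symm (fun _ => Iff.rfl)).trans
      (Equiv.subtypeProdEquivProd (p := fun a : Fin N => (a : ℕ) < e₁)
        (q := fun b : Fin M => (b : ℕ) < e₂))
  have hq : Fintype.card {y : Fin (N * M) // (((finProdFinEquiv.symm y).1 : Fin N) : ℕ) < e₁ ∧
      (((finProdFinEquiv.symm y).2 : Fin M) : ℕ) < e₂} = e₁ * e₂ := by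
    rw [Fintype.card_congr eq, Fintype.card_prod, Fintype.card_fin_lt_of_le h₁,
      Fintype.card_fin_lt_of_le h₂]
  have hpc : Fintype.card {z : Fin (N * M) // ¬ (z : ℕ) < e₁ * e₂} =
      Fintype.card {y : Fin (N * M) // ¬ ((((finProdFinEquiv.symm y).1 : Fin N) : ℕ) < e₁ ∧
        (((finProdFinEquiv.symm y).2 : Fin M) : ℕ) < e₂)} := by
    rw [Fintype.card_subtype_compl, Fintype.card_subtype_compl, hp, hq]
  let e := Fintype.equivOfCardEq (hp.trans hq.symm)
  let f := Fintype.equivOfCardEq hpc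
  refine ⟨Equiv.subtypeCongr e f, fun z => ?_⟩
  by_cases hz : (z : ℕ) < e₁ * e₂
  · have h : Equiv.subtypeCongr e f z = e ⟨z, hz⟩ := by
      simp only [Equiv.subtypeCongr, Equiv.trans_apply, Equiv.sumCongr_apply]
      rw [Equiv.sumCompl_symm_apply_of_pos (p := fun x : Fin (N * M) => (x : ℕ) < e₁ * e₂)
        (a := z) hz, Sum.map_inl, Equiv.sumCompl_apply_inl]
    rw [h]
    exact iff_of_true (e ⟨z, hz⟩).2 hz
  · have h : Equiv.subtypeCongr e f z = f ⟨z, hz⟩ := by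
      simp only [Equiv.subtypeCongr, Equiv.trans_apply, Equiv.sumCongr_apply]
      rw [Equiv.sumCompl_symm_apply_of_neg (p := fun x : Fin (N * M) => (x : ℕ) < e₁ * e₂)
        (a := z) hz, Sum.map_inr, Equiv.sumCompl_apply_inr]
    rw [h]
    exact iff_of_false (f ⟨z, hz⟩).2 hz

end Box

/-! ## §3 The Kronecker product in the bond -/

section Kron

variable {F : Type*} [Field F]

/-- **The embedding, pointwise.** Relabel edge `01` at level `N·M` by a box permutation `σ` (identity
on the other five edges, `relab₀₁`): then the Kronecker product `W_N^{(e₁)} ⊠ W_M^{(e₂)}` (first pair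
components through `W_N^{(e₁)}`, second through `W_M^{(e₂)}`) pulls back to `W_{N·M}^{(e₁·e₂)}` — the
two tetrahedron factors recombine (`tetra_mul_apply`, `tetra_relab₀₁`) and the box test becomes the
initial-segment test. [cite: ChristandlVranaZuiddam2016, §1.1 (graph tensors multiply under ⊠)] -/
theorem sixKron_pullback_apply {N M e₁ e₂ : ℕ} (σ : Equiv.Perm (Fin (N * M)))
    (hσ : ∀ z : Fin (N * M),
      ((((finProdFinEquiv.symm (σ z)).1 : Fin N) : ℕ) < e₁ ∧
          (((finProdFinEquiv.symm (σ z)).2 : Fin M) : ℕ) < e₂) ↔ (z : ℕ) < e₁ * e₂)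
    (x : Fin 4 → Fin ((N * M) ^ 3)) :
    sixTetra F N e₁ (fun v => K₁ (relab₀₁ σ v (x v))) *
        sixTetra F M e₂ (fun v => K₂ (relab₀₁ σ v (x v))) =
      sixTetra F (N * M) (e₁ * e₂) x := by
  have ht : tetra F N (fun v => K₁ (relab₀₁ σ v (x v))) *
      tetra F M (fun v => K₂ (relab₀₁ σ v (x v))) = tetra F (N * M) x := by
    rw [← tetra_mul_apply (F := F) (fun v => relab₀₁ σ v (x v)), tetra_relab₀₁]
  have hind : thinInd F N e₁ 0 (K₁ (relab₀₁ σ 0 (x 0))) * thinInd F M e₂ 0 (K₂ (relab₀₁ σ 0 (x 0))) =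
      thinInd F (N * M) (e₁ * e₂) 0 (x 0) := by
    simp only [thinInd, symm_K₁_apply, symm_K₂_apply, symm_relab₀₁_zero_zero, ite_one_zero_mul_ite]
    exact if_congr (hσ _) rfl rfl
  simp only [sixTetra]
  rw [mul_mul_mul_comm, hind, ht]

/-- **Kronecker sub-multiplicativity in the bond**:
`R₄(W_{N·M}^{(e₁·e₂)}) ≤ R₄(W_N^{(e₁)}) · R₄(W_M^{(e₂)})` for `e₁ ≤ N`, `e₂ ≤ M` — the products of the
legs of two rank-one decompositions decompose the Kronecker product, of which `W_{N·M}^{(e₁·e₂)}` is a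
pullback (`sixKron_pullback_apply` along a box permutation, `exists_perm_box`).
[cite: ChristandlVranaZuiddam2016, Prop. 1.1.16 (proof)] -/
theorem tensorRankD_sixTetra_kron_le {N M e₁ e₂ : ℕ} (h₁ : e₁ ≤ N) (h₂ : e₂ ≤ M) :
    tensorRankD (sixTetra F (N * M) (e₁ * e₂)) ≤
      tensorRankD (sixTetra F N e₁) * tensorRankD (sixTetra F M e₂) := by
  classical
  obtain ⟨σ, hσ⟩ := exists_perm_box h₁ h₂
  obtain ⟨u₁, hu₁⟩ := exists_rankOne_decomposition_sixTetra (F := F) N e₁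
  obtain ⟨u₂, hu₂⟩ := exists_rankOne_decomposition_sixTetra (F := F) M e₂
  obtain ⟨u, hu⟩ := exists_rankOne_decomposition_mulK hu₁ hu₂
  have key : sixTetra F (N * M) (e₁ * e₂) = fun x : Fin 4 → Fin ((N * M) ^ 3) =>
      (fun i : Fin 4 → Fin ((N * M) ^ 3) =>
        sixTetra F N e₁ (fun v => K₁ (i v)) * sixTetra F M e₂ (fun v => K₂ (i v)))
        (fun v => relab₀₁ σ v (x v)) := by
    funext x
    exact (sixKron_pullback_apply σ hσ x).symm
  rw [key]
  refine (tensorRankD_pullback_le _ (fun v y => relab₀₁ σ v y)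
    ⟨_, fun k => rankOneTensor (u k), fun k => rankOneTensor_mem _, hu⟩).trans ?_
  exact tensorRankD_le_of_eq_sum u hu

/-- **Thin ⊠ full**: `R₄(W_{N·M}^{(e·M)}) ≤ R₄(W_N^{(e)}) · R₄(T(K₄)_M)` for `e ≤ N` (the case `e₂ = M`,
`W_M^{(M)} = T(K₄)_M`). [cite: ChristandlVranaZuiddam2016, Prop. 1.1.16 (proof)] -/
theorem tensorRankD_sixTetra_kron_tetra_le {N M e : ℕ} (h : e ≤ N) :
    tensorRankD (sixTetra F (N * M) (e * M)) ≤
      tensorRankD (sixTetra F N e) * tensorRankD (tetra F M) := by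
  rw [← sixTetra_of_le (F := F) (le_refl M)]
  exact tensorRankD_sixTetra_kron_le h le_rfl

/-- **Squares**: `R₄(W_{n·n}^{(e·e)}) ≤ R₄(W_n^{(e)})²` (`e ≤ n`). [cite: ChristandlVranaZuiddam2016, Prop. 1.1.16 (proof)] -/
theorem tensorRankD_sixTetra_sq_le {n e : ℕ} (h : e ≤ n) :
    tensorRankD (sixTetra F (n * n) (e * e)) ≤ tensorRankD (sixTetra F n e) ^ 2 := by
  rw [sq]
  exact tensorRankD_sixTetra_kron_le h h

end Kron

end Summit.MatrixMultiplication.MatrixMultiplication.Theorems.EdgePencil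

end
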